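import Literature.Geometry.Symplectic.NearSymplecticForms
import Literature.Geometry.Symplectic.HondaUntwistedModel
import Literature.Geometry.Symplectic.OrigamiCutFormProduct
import HarnessLib

/-!
# The untwisted model `Θ = ω_A` is a near-symplectic form on `ℝ⁴` with zero set the axis

Topic `Literature/Geometry/Symplectic` (groundwork for the named fact
`Literature.Geometry.Symplectic.relNearSymplecticTaubesTubes_exists`; everything PROVED, no named
facts).  Perutz 2006, §2: with `β₁ = dt∧dx₁ + dx₂∧dx₃`, `β₂ = dt∧dx₂ + dx₃∧dx₁`,
`β₃ = dt∧dx₃ + dx₁∧dx₂` on Euclidean `ℝ⁴` (positively oriented coordinates `(t, x₁, x₂, x₃)`),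
"Define `Θ = x₁β₁ + x₂β₂ − 2x₃β₃`, so that `Θ² = 2(x₁² + x₂² + 4x₃²) dt∧dx₁∧dx₂∧dx₃`.  The form
`Θ` is near-symplectic with zero-set `Z_Θ = {x₁ = x₂ = x₃ = 0}`."  (`Θ` is Honda's `ω_A`,
`hondaFormA` of `HondaUntwistedModel.lean`.)

## Content

* `hondaBeta₁`, `hondaBeta₂`, `hondaBeta₃` — the three constant self-dual forms `βᵢ` as honest
  continuous alternating maps on `ℝ⁴` (antisymmetrisations of bilinear maps in the coordinate
  functionals), with their values;
* `hondaFormCLM : ℝ⁴ →L (Λ²)` — `q ↦ Θ_q = q₁β₁ + q₂β₂ − 2q₃β₃`, LINEAR in the point;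
  `hondaMForm : MForm (𝓡 4) ℝ⁴ ℝ 2` — `Θ` as a `2`-form on the manifold `ℝ⁴`, with
  `hondaMForm q (U, V) = hondaFormA q U V`;
* PROVED: `Θ` is smooth and CLOSED (`dΘ = dx₁∧β₁ + dx₂∧β₂ − 2dx₃∧β₃ = (1 + 1 − 2) dt∧dx₁₂₃ = 0`,
  via Mathlib's `extDeriv` on the model space), `Pf(Θ_q) = q₁² + q₂² + 4q₃²`
  (`Θ² = 2 Pf(Θ) dt∧dx₁∧dx₂∧dx₃`), `Z_Θ = hondaAxis`, the gradient of `Θ` is `hondaFormCLM`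
  itself with kernel the line `ℝ · ∂_t` and rank `3`, hence every point of the axis is a transverse
  zero and every other point has `Θ ∧ Θ > 0` for the standard orientation:
  **`isNearSymplectic_hondaMForm : IsNearSymplectic (SmoothOrientation.euclidean 4) hondaMForm`**
  — non-vacuity of `IsNearSymplectic` / `IsTransverseZero` (`NearSymplecticForms.lean`) and the
  model for Honda model charts (`NearSymplecticModelChartsReduction.lean`).

## References

* T. Perutz, *Zero-sets of near-symplectic forms*, J. Symplectic Geom. 4 (2006), §2, eq. (1)–(2)
  and the sentence following (2) [Perutz2006].
* K. Honda, *Local properties of self-dual harmonic 2-forms on a 4-manifold*, J. reine angew.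
  Math. 577 (2004), §4 Thm. 4 (A) [Honda2004LocalSD].
-/

noncomputable section

open scoped Manifold ContDiff Topology
open Set Function Literature.Geometry.Kaehler Literature.Topology.FourManifolds

namespace Literature.Geometry.Symplectic

/-- Local notation for the model space `ℝ⁴ = EuclideanSpace ℝ (Fin 4)`. -/
local notation "E4" => EuclideanSpace ℝ (Fin 4)

/-! ### Constant alternating `2`-forms on `ℝ⁴` from bilinear maps -/

/-- The antisymmetrisation `(v, w) ↦ B(v, w) − B(w, v)` of a continuous bilinear map on `ℝ⁴`, as
a continuous alternating `2`-map (Mathlib's `ContinuousMultilinearMap.alternatization` of the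
uncurried map, as in `Bundle.RiemannianMetric.kaehlerForm`). [folklore] -/
def altTwoOfBilinFour (B : E4 →L[ℝ] E4 →L[ℝ] ℝ) : E4 [⋀^Fin 2]→L[ℝ] ℝ :=
  ContinuousMultilinearMap.alternatization
    (ContinuousLinearMap.uncurryLeft
      (((continuousMultilinearCurryFin1 ℝ E4 ℝ).symm : (E4 →L[ℝ] ℝ) →L[ℝ] _).comp B))

/-- `altTwoOfBilinFour B (v, w) = B v w − B w v`. [folklore] -/
@[simp]
theorem altTwoOfBilinFour_apply (B : E4 →L[ℝ] E4 →L[ℝ] ℝ) (v w : E4) :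
    altTwoOfBilinFour B ![v, w] = B v w - B w v := by
  simp only [altTwoOfBilinFour, ContinuousMultilinearMap.alternatization_apply_apply]
  have huniv : (Finset.univ : Finset (Equiv.Perm (Fin 2))) = {1, Equiv.swap 0 1} := by decide
  rw [huniv, Finset.sum_pair (by decide)]
  simp [Equiv.Perm.sign_swap', Units.smul_def, sub_eq_add_neg]

/-- The coordinate functional `dxᵢ` on `ℝ⁴`. [folklore] -/
abbrev dxFour (i : Fin 4) : E4 →L[ℝ] ℝ := EuclideanSpace.proj i

/-- `dxᵢ(v) = vᵢ`. [folklore] -/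
@[simp] theorem dxFour_apply (i : Fin 4) (v : E4) : dxFour i v = v i := rfl

/-- **`β₁ = dt ∧ dx₁ + dx₂ ∧ dx₃`** (Perutz 2006, §2 eq. (1); coordinates
`(t, x₁, x₂, x₃) = (q 0, q 1, q 2, q 3)`). [cite: Perutz2006, §2 eq. (1)] -/
def hondaBeta₁ : E4 [⋀^Fin 2]→L[ℝ] ℝ :=
  altTwoOfBilinFour ((dxFour 0).smulRight (dxFour 1) + (dxFour 2).smulRight (dxFour 3))

/-- **`β₂ = dt ∧ dx₂ + dx₃ ∧ dx₁`** (Perutz 2006, §2 eq. (1)). [cite: Perutz2006, §2 eq. (1)] -/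
def hondaBeta₂ : E4 [⋀^Fin 2]→L[ℝ] ℝ :=
  altTwoOfBilinFour ((dxFour 0).smulRight (dxFour 2) + (dxFour 3).smulRight (dxFour 1))

/-- **`β₃ = dt ∧ dx₃ + dx₁ ∧ dx₂`** (Perutz 2006, §2 eq. (1)). [cite: Perutz2006, §2 eq. (1)] -/
def hondaBeta₃ : E4 [⋀^Fin 2]→L[ℝ] ℝ :=
  altTwoOfBilinFour ((dxFour 0).smulRight (dxFour 3) + (dxFour 1).smulRight (dxFour 2))

/-- Values of `β₁`. [folklore] -/
@[simp] theorem hondaBeta₁_apply (U V : E4) :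
    hondaBeta₁ ![U, V] = U 0 * V 1 - V 0 * U 1 + (U 2 * V 3 - V 2 * U 3) := by
  simp [hondaBeta₁]; ring

/-- Values of `β₂`. [folklore] -/
@[simp] theorem hondaBeta₂_apply (U V : E4) :
    hondaBeta₂ ![U, V] = U 0 * V 2 - V 0 * U 2 + (U 3 * V 1 - V 3 * U 1) := by
  simp [hondaBeta₂]; ring

/-- Values of `β₃`. [folklore] -/
@[simp] theorem hondaBeta₃_apply (U V : E4) :
    hondaBeta₃ ![U, V] = U 0 * V 3 - V 0 * U 3 + (U 1 * V 2 - V 1 * U 2) := by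
  simp [hondaBeta₃]; ring

/-! ### `Θ = x₁β₁ + x₂β₂ − 2x₃β₃` as a form on the manifold `ℝ⁴` -/

/-- **`Θ` as a continuous LINEAR map of the point**: `q ↦ Θ_q = q₁β₁ + q₂β₂ − 2q₃β₃`
(Perutz 2006, §2 eq. (2)); being linear, it is its own derivative, which is the intrinsic
gradient of `Θ` along the axis. [cite: Perutz2006, §2 eq. (2)] -/
def hondaFormCLM : E4 →L[ℝ] (E4 [⋀^Fin 2]→L[ℝ] ℝ) :=
  (dxFour 1).smulRight hondaBeta₁ + (dxFour 2).smulRight hondaBeta₂ -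
    (2 : ℝ) • (dxFour 3).smulRight hondaBeta₃

/-- `Θ_q (U, V) = ω_A(q)(U, V)`: the packaged form evaluates to `hondaFormA`. [folklore] -/
@[simp] theorem hondaFormCLM_apply (q U V : E4) : hondaFormCLM q ![U, V] = hondaFormA q U V := by
  simp [hondaFormCLM, hondaFormA, hondaDQ]
  ring

/-- `Θ_q v = ω_A(q)(v 0, v 1)` on an arbitrary `2`-vector. [folklore] -/
theorem hondaFormCLM_apply' (q : E4) (v : Fin 2 → E4) :
    hondaFormCLM q v = hondaFormA q (v 0) (v 1) := by
  have hv : ![v 0, v 1] = v := by funext i; fin_cases i <;> rfl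
  rw [← hv, hondaFormCLM_apply]; rfl

/-- **The untwisted model `Θ = ω_A` as a `2`-form on the manifold `ℝ⁴`** (model `𝓡 4`, tangent
spaces `= ℝ⁴`; Perutz 2006, §2 eq. (2); Honda 2004, Thm. 4 (A)). [cite: Perutz2006, §2 eq. (2)] -/
def hondaMForm : MForm (𝓡 4) E4 ℝ 2 := fun q => hondaFormCLM q

/-- `Θ_q(U, V) = ω_A(q)(U, V)`. [folklore] -/
@[simp] theorem hondaMForm_apply (q U V : E4) : hondaMForm q ![U, V] = hondaFormA q U V :=
  hondaFormCLM_apply q U V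

/-- `Θ` vanishes at `q` iff `ω_A(q)` vanishes on all pairs of vectors. [folklore] -/
theorem hondaMForm_eq_zero_iff (q : E4) : hondaMForm q = 0 ↔ ∀ U V : E4, hondaFormA q U V = 0 := by
  constructor
  · intro h U V
    rw [← hondaMForm_apply, h]; rfl
  · intro h
    ext v
    change hondaFormCLM q v = 0
    rw [hondaFormCLM_apply', h]

/-- **`Z_Θ = {x₁ = x₂ = x₃ = 0}`** (Perutz 2006, §2: "zero-set `Z_Θ = {x₁ = x₂ = x₃ = 0}`").
[cite: Perutz2006, §2 eq. (2)] -/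
theorem zeroLocus_hondaMForm : zeroLocus hondaMForm = hondaAxis := by
  ext q
  rw [mem_zeroLocus, hondaMForm_eq_zero_iff, forall_hondaFormA_eq_zero_iff]

/-! ### Smoothness and closedness -/

/-- `Θ` is a smooth form (its chart representative is the linear map `hondaFormCLM`). [folklore] -/
theorem isSmoothForm_hondaMForm : IsSmoothForm hondaMForm := by
  intro x
  rw [inChart_eq_self_model]
  exact (hondaFormCLM.contDiff.contDiffAt).contDiffWithinAt

/-- `removeNth` on `Fin 3`, index `0`. [folklore] -/
theorem removeNth_zero_vecThree (v : Fin 3 → E4) : Fin.removeNth (0 : Fin 3) v = ![v 1, v 2] := by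
  funext i; fin_cases i <;> rfl

/-- `removeNth` on `Fin 3`, index `1`. [folklore] -/
theorem removeNth_one_vecThree (v : Fin 3 → E4) : Fin.removeNth (1 : Fin 3) v = ![v 0, v 2] := by
  funext i; fin_cases i <;> rfl

/-- `removeNth` on `Fin 3`, index `2`. [folklore] -/
theorem removeNth_two_vecThree (v : Fin 3 → E4) : Fin.removeNth (2 : Fin 3) v = ![v 0, v 1] := by
  funext i; fin_cases i <;> rfl

/-- **`dΘ = 0` pointwise**: the cyclic sum `ω_A(a)(b, c) − ω_A(b)(a, c) + ω_A(c)(a, b)` vanishes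
identically (`dΘ = Σ dxⱼ ∧ βⱼ`-terms `= (1 + 1 − 2) dt ∧ dx₁ ∧ dx₂ ∧ dx₃ = 0`: the coefficient matrix
`diag(1, 1, −2)` is symmetric and trace-free). [cite: Perutz2006, §2 eq. (2)] -/
theorem hondaFormA_cyclic (a b c : E4) :
    hondaFormA a b c - hondaFormA b a c + hondaFormA c a b = 0 := by
  simp only [hondaFormA, hondaDQ]; ring

/-- The exterior derivative of `Θ` (as the constant `3`-form `Alt(hondaFormCLM)`) vanishes.
[folklore] -/
theorem alternatizeUncurryFin_hondaFormCLM :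
    ContinuousAlternatingMap.alternatizeUncurryFin hondaFormCLM = 0 := by
  ext v
  rw [ContinuousAlternatingMap.alternatizeUncurryFin_apply, Fin.sum_univ_three]
  rw [show (0 : E4 [⋀^Fin 3]→L[ℝ] ℝ) v = 0 from rfl]
  simp only [Fin.val_zero, pow_zero, one_smul, Fin.val_one, pow_one, neg_smul, Fin.val_two,
    removeNth_zero_vecThree, removeNth_one_vecThree, removeNth_two_vecThree, hondaFormCLM_apply]
  have := hondaFormA_cyclic (v 0) (v 1) (v 2)
  norm_num
  linarith

/-- **`Θ` is closed** (Perutz 2006, §2: `Θ` is near-symplectic, in particular `dΘ = 0`; on the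
model space the manifold exterior derivative is Mathlib's `extDeriv`, `mextDeriv_eq_extDeriv`, and
the derivative of the linear map `q ↦ Θ_q` is itself). [cite: Perutz2006, §2 eq. (2)] -/
theorem isClosedForm_hondaMForm : IsClosedForm hondaMForm := by
  change mextDeriv hondaMForm = 0
  funext x
  rw [mextDeriv_eq_extDeriv, extDeriv]
  have hf : fderiv ℝ hondaMForm x = hondaFormCLM := hondaFormCLM.fderiv
  rw [hf, alternatizeUncurryFin_hondaFormCLM]
  rfl

/-! ### The Pfaffian, the gradient, and near-symplecticity -/

/-- **`Pf(Θ_q) = q₁² + q₂² + 4q₃²`**, i.e. `Θ ∧ Θ = 2(x₁² + x₂² + 4x₃²) dt ∧ dx₁ ∧ dx₂ ∧ dx₃`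
(Perutz 2006, §2, after eq. (2)). [cite: Perutz2006, §2 eq. (2)] -/
theorem pfaffian_hondaMForm (q : E4) :
    pfaffian (hondaMForm q) = q 1 ^ 2 + q 2 ^ 2 + 4 * q 3 ^ 2 := by
  simp [pfaffian, stdVec, hondaMForm, hondaFormA, hondaDQ]
  ring

/-- Off the axis the Pfaffian of `Θ` is positive. [folklore] -/
theorem pfaffian_hondaMForm_pos {q : E4} (hq : q ∉ hondaAxis) : 0 < pfaffian (hondaMForm q) := by
  rw [pfaffian_hondaMForm]
  rw [mem_hondaAxis, not_and_or, not_and_or] at hq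
  rcases hq with h | h | h
  · have := sq_pos_of_ne_zero h; positivity
  · have := sq_pos_of_ne_zero h; positivity
  · have := sq_pos_of_ne_zero h; positivity

/-- **Off the axis `Θ ∧ Θ > 0` for the standard orientation of `ℝ⁴`.** [cite: Perutz2006, §2 eq. (2)] -/
theorem isWedgeSqPos_hondaMForm {q : E4} (hq : q ∉ hondaAxis) :
    IsWedgeSqPos (SmoothOrientation.euclidean 4) hondaMForm q := by
  have hpos := pfaffian_hondaMForm_pos hq
  refine ⟨hpos.ne', ?_⟩
  rw [SmoothOrientation.euclidean_apply]
  unfold signOrientationIn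
  rw [if_pos hpos]

/-- **The gradient of `Θ` is `hondaFormCLM` at every point** (a linear map is its own
derivative; the charts of the model space are the identity). [folklore] -/
theorem zeroGradient_hondaMForm (q : E4) : zeroGradient hondaMForm q = hondaFormCLM := by
  rw [zeroGradient, inChart_eq_self_model]
  exact hondaFormCLM.fderiv

/-- `Θ_U = 0` iff `U` is on the axis `ℝ · ∂_t`: the kernel of the gradient. [folklore] -/
theorem hondaFormCLM_eq_zero_iff (U : E4) : hondaFormCLM U = 0 ↔ U ∈ hondaAxis := by
  change U ∈ zeroLocus hondaMForm ↔ U ∈ hondaAxis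
  rw [zeroLocus_hondaMForm]

/-- **The kernel of the gradient of `Θ` is the line `ℝ · ∂_t`** (the tangent line of the zero
set). [cite: Perutz2006, §2 eq. (2)] -/
theorem ker_hondaFormCLM :
    LinearMap.ker hondaFormCLM.toLinearMap = ℝ ∙ (EuclideanSpace.single (0 : Fin 4) (1 : ℝ)) := by
  ext U
  rw [LinearMap.mem_ker, ContinuousLinearMap.coe_coe, hondaFormCLM_eq_zero_iff, mem_hondaAxis,
    Submodule.mem_span_singleton]
  constructor
  · rintro ⟨h1, h2, h3⟩
    refine ⟨U 0, ?_⟩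
    ext i
    fin_cases i <;> simp [h1, h2, h3]
  · rintro ⟨a, rfl⟩
    simp

/-- **The gradient of `Θ` has rank `3`** (rank–nullity: its kernel is a line in `ℝ⁴`).
[cite: Perutz2006, §2 eq. (2)] -/
theorem finrank_range_hondaFormCLM :
    Module.finrank ℝ (LinearMap.range hondaFormCLM.toLinearMap) = 3 := by
  have hrn := LinearMap.finrank_range_add_finrank_ker hondaFormCLM.toLinearMap
  have hker : Module.finrank ℝ (LinearMap.ker hondaFormCLM.toLinearMap) = 1 := by
    rw [ker_hondaFormCLM]
    exact finrank_span_singleton (by simp)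
  rw [hker, finrank_euclideanSpace_fin] at hrn
  omega

/-- **Every point of the axis is a transverse zero of `Θ`.** [cite: Perutz2006, §2 eq. (2)] -/
theorem isTransverseZero_hondaMForm {q : E4} (hq : q ∈ hondaAxis) : IsTransverseZero hondaMForm q := by
  refine ⟨?_, ?_⟩
  · change q ∈ zeroLocus hondaMForm
    rw [zeroLocus_hondaMForm]; exact hq
  · rw [zeroGradient_hondaMForm]; exact finrank_range_hondaFormCLM

/-- **`Θ` is near-positive for the standard orientation of `ℝ⁴`.** [cite: Perutz2006, §2 eq. (2)] -/
theorem isNearPositive_hondaMForm : IsNearPositive (SmoothOrientation.euclidean 4) hondaMForm := by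
  intro q
  by_cases hq : q ∈ hondaAxis
  · exact Or.inr (isTransverseZero_hondaMForm hq)
  · exact Or.inl (isWedgeSqPos_hondaMForm hq)

/-- **The untwisted model `Θ = ω_A` is a near-symplectic form on `ℝ⁴` (standard orientation) with
zero set the axis** (Perutz 2006, §2: "The form `Θ` is near-symplectic with zero-set
`Z_Θ = {x₁ = x₂ = x₃ = 0}`"). [cite: Perutz2006, §2 eq. (2)] -/
theorem isNearSymplectic_hondaMForm : IsNearSymplectic (SmoothOrientation.euclidean 4) hondaMForm :=
  ⟨isSmoothForm_hondaMForm, isClosedForm_hondaMForm, isNearPositive_hondaMForm⟩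

end Literature.Geometry.Symplectic

end
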